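import Mathlib.Topology.Baire.Lemmas
import Mathlib.Topology.Baire.LocallyCompactRegular
import Mathlib.Topology.Algebra.OpenSubgroup
import Mathlib.Topology.Algebra.Group.Quotient
import Mathlib.Topology.Algebra.Group.Pointwise
import Mathlib.Algebra.Group.Subgroup.Pointwise
import Mathlib.Algebra.Group.Pointwise.Set.Basic
import Mathlib.GroupTheory.Index
import HarnessLib

/-!
# Baire category in topological groups: `K_σ` subgroups of countable index are open

Classical consequences of the Baire category theorem for topological groups.  SOURCES: Su Gao,
*Invariant Descriptive Set Theory*, CRC Press (2009), §2.3: Prop. 2.3.1 (Baire groups), Thm. 2.3.2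
(Pettis: for a nonmeager `A` with the Baire property `A⁻¹A` is a neighbourhood of `1`; "if `A` is in
addition a subgroup, then `A` is open"), Exercise 2.3.3, Exercise 2.2.6 (a closed subgroup of a Polish
group has countable index iff it is clopen) [cite: Gao2009InvariantDST, §2.3 Thm 2.3.2]; Dixon–du
Sautoy–Mann–Segal, *Analytic pro-p groups* (2nd ed., 1999): Prop. 1.2 (i) (open subgroups of a
profinite group are closed of finite index; a closed subgroup is open iff it has finite index), Ch. 3
Exercise 6 (Baire category theorem for profinite spaces: if `G = ⋃ Mᵢ` with `Mᵢ` closed then some `Mₙ`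
contains a non-empty open subset) and Ch. 1 Exercise 18 (i) (for a closed subset `S` of a profinite
group, `S^∞ = ⋃ₙ S⁽ⁿ⁾` is closed iff `S^∞ = S⁽ⁿ⁾` for some `n` — "use Baire's Category Theorem")
[cite: DDMSAnalyticProP1999, Ch.1 Exercise 18].  We give the direct Baire-category proofs (a countable
closed cover of a Baire space has a member with non-empty interior — Mathlib's
`nonempty_interior_of_iUnion_of_closed`), in the generality of Baire topological groups where the
statements allow it.  Everything is Mathlib-only and generic; no definition and no named fact is
introduced (PROOF-ONLY file).

* `exists_nonempty_interior_of_countable_quotient_of_iUnion_isClosed`,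
  `isOpen_of_countable_quotient_of_iUnion_isClosed` — in a Baire topological group a subgroup `H` which
  is a countable union of closed sets `K i` ("`K_σ`") and has countable index (`Countable (G ⧸ H)`) has
  some `K i` with non-empty interior, hence is OPEN (finite-index form `…_of_finiteIndex_…`);
* for COMPACT `G` (automatically Baire: topological groups are regular, hence `R₁`, and compact ⇒
  locally compact): `finite_quotient_of_isOpen` (open subgroups have finite index) and the
  equivalences, for a `K_σ` subgroup `H = ⋃ i, K i`:
  `H` open ⟺ `Countable (G ⧸ H)` ⟺ `∃ i, (interior (K i)).Nonempty`
  (`isOpen_iff_countable_quotient_of_iUnion_isClosed`,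
  `isOpen_iff_exists_nonempty_interior_of_iUnion_isClosed`);
* WORD-WIDTH FORM: the ABSTRACT subgroup `Subgroup.closure S` generated by a COMPACT subset `S` of a
  Hausdorff topological group is `K_σ` — it is `⋃ n, (S ∪ S⁻¹) ^ n` with every `(S ∪ S⁻¹) ^ n` compact
  (`coe_closure_eq_iUnion_pow_union_inv`, `isCompact_union_inv_pow`); so in a compact Hausdorff group
  `Subgroup.closure S` is open ⟺ it has countable index ⟺ some bounded-width product set
  `(S ∪ S⁻¹) ^ n` has non-empty interior (`isOpen_closure_iff_countable_quotient_of_isCompact`,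
  `isOpen_closure_iff_exists_nonempty_interior_pow_of_isCompact`); in particular an abstract subgroup
  generated by a compact set is open as soon as it has finite index
  (`isOpen_closure_of_finiteIndex_of_isCompact`);
* FINITE-KERNEL LIFTING: if `N ⊴ G` is finite and `H ⊔ N` is open (equivalently the image of `H` in
  `G ⧸ N` is open), then a `K_σ` subgroup `H` of a compact group is open
  (`isOpen_of_isOpen_sup_of_finite_normal`, `isOpen_of_isOpen_map_mk_of_finite_normal`);
* DDMS Ch. 1 EXERCISE 18 (i): for a closed symmetric `S ∋ 1` in a compact Hausdorff group,
  `⋃ n, S ^ n` is closed iff `⋃ n, S ^ n = S ^ n` for some `n` (`isClosed_iUnion_pow_iff_exists_eq_pow`,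
  `exists_iUnion_pow_eq_pow_of_isClosed`) — "closed ⟺ finite width".

Context (cell abc-iut, GAP-LEDGER G-L3d2g2-1, desk items (R3)/(R4) now in the kernel): for a verbal
abstract subgroup `A = ⟨w-values⟩` of a profinite group, "`A` closed/open" ⟺ "`A` has countable index"
⟺ "some bounded-width set of `w`-products has non-empty interior" ⟺ "finite width" — where uniform
width bounds (Nikolov–Segal-type theorems, NOT proved or asserted here) enter.  Nothing here is specific
to, or takes a side on, inter-universal Teichmüller theory or [IUTchIII] Cor. 3.12.
-/

namespace Literature.GroupTheory

open scoped _root_.Topology _root_.Pointwise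
open _root_.Set

variable {G : Type*} [Group G] [TopologicalSpace G] [IsTopologicalGroup G]

/-! ### Baire groups: a `K_σ` subgroup of countable index has a piece with interior, hence is open -/

section Baire

variable [BaireSpace G]

/-- **Baire category, subgroup form.** In a Baire topological group, if a subgroup `H` is a countable
union of closed sets `K i` and has countable index, then some `K i` has non-empty interior: the
countably many closed left translates `g • K i` (`g` running over coset representatives) cover `G`
(Gao: Prop. 2.3.1 / Pettis' theorem 2.3.2 specialised to `F_σ` sets; DDMS Ch. 3 Ex. 6 is the profinite
Baire category theorem). [cite: Gao2009InvariantDST, §2.3 Thm 2.3.2 (Pettis) and Exercise 2.3.3]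
[cite: DDMSAnalyticProP1999, Ch.3 Exercise 6] -/
theorem exists_nonempty_interior_of_countable_quotient_of_iUnion_isClosed (H : Subgroup G)
    [Countable (G ⧸ H)] {ι : Type*} [Countable ι] {K : ι → Set G} (hK : ∀ i, IsClosed (K i))
    (hHK : (H : Set G) = ⋃ i, K i) : ∃ i, (interior (K i)).Nonempty := by
  classical
  -- the closed translates `out(q) * K i`, `q : G ⧸ H`, `i : ι`
  let F : (G ⧸ H) × ι → Set G := fun q => (fun x => q.1.out * x) '' K q.2
  have hFc : ∀ q, IsClosed (F q) := fun q => isClosedMap_mul_left _ _ (hK q.2)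
  have hFU : (⋃ q, F q) = univ := by
    refine eq_univ_of_forall fun g => ?_
    obtain ⟨h, hh⟩ := QuotientGroup.mk_out_eq_mul H g
    have hmem : ((h : G)⁻¹) ∈ (H : Set G) := H.inv_mem h.2
    rw [hHK, mem_iUnion] at hmem
    obtain ⟨i, hi⟩ := hmem
    refine mem_iUnion.mpr ⟨((QuotientGroup.mk g : G ⧸ H), i), (h : G)⁻¹, hi, ?_⟩
    show (QuotientGroup.mk g : G ⧸ H).out * (h : G)⁻¹ = g
    rw [hh, mul_inv_cancel_right]
  obtain ⟨q, hq⟩ := nonempty_interior_of_iUnion_of_closed hFc hFU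
  refine ⟨q.2, ?_⟩
  have himg : interior (F q) = (fun x => q.1.out * x) '' interior (K q.2) :=
    ((Homeomorph.mulLeft q.1.out).image_interior (K q.2)).symm
  rw [himg] at hq
  exact hq.of_image

omit [BaireSpace G] in
/-- A subgroup containing a set with an interior point is open (translate the interior point to `1`).
[folklore] -/
private theorem isOpen_of_nonempty_interior_of_subset (H : Subgroup G) {K : Set G} (hKH : K ⊆ (H : Set G))
    (hK : (interior K).Nonempty) : IsOpen (H : Set G) := by
  obtain ⟨x, hx⟩ := hK
  exact H.isOpen_of_mem_nhds (mem_interior_iff_mem_nhds.mp (interior_mono hKH hx))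

/-- **A `K_σ` subgroup of countable index in a Baire topological group is open** (Gao Thm. 2.3.2 /
Exercise 2.3.3 for the `F_σ` subgroup `H`, nonmeager as countably many translates cover `G`). [cite: Gao2009InvariantDST, §2.3 Thm 2.3.2 (Pettis) and Exercise 2.3.3] -/
theorem isOpen_of_countable_quotient_of_iUnion_isClosed (H : Subgroup G) [Countable (G ⧸ H)]
    {ι : Type*} [Countable ι] {K : ι → Set G} (hK : ∀ i, IsClosed (K i))
    (hHK : (H : Set G) = ⋃ i, K i) : IsOpen (H : Set G) := by
  obtain ⟨i, hi⟩ := exists_nonempty_interior_of_countable_quotient_of_iUnion_isClosed H hK hHK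
  exact isOpen_of_nonempty_interior_of_subset H (hHK ▸ subset_iUnion K i) hi

/-- **A `K_σ` subgroup of finite index in a Baire topological group is open.** [cite: Gao2009InvariantDST, §2.3 Thm 2.3.2 (Pettis) and Exercise 2.3.3] -/
theorem isOpen_of_finiteIndex_of_iUnion_isClosed (H : Subgroup G) [H.FiniteIndex]
    {ι : Type*} [Countable ι] {K : ι → Set G} (hK : ∀ i, IsClosed (K i))
    (hHK : (H : Set G) = ⋃ i, K i) : IsOpen (H : Set G) :=
  haveI : Finite (G ⧸ H) := Subgroup.finite_quotient_of_finiteIndex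
  isOpen_of_countable_quotient_of_iUnion_isClosed H hK hHK

/-- A CLOSED subgroup of countable index in a Baire topological group is open (the case of a single
closed piece; Gao Exercise 2.2.6 states the Polish case). [cite: Gao2009InvariantDST, §2.2 Exercise 2.2.6]
[cite: Gao2009InvariantDST, §2.3 Thm 2.3.2 (Pettis) and Exercise 2.3.3] -/
theorem isOpen_of_countable_quotient_of_isClosed (H : Subgroup G) [Countable (G ⧸ H)]
    (hH : IsClosed (H : Set G)) : IsOpen (H : Set G) :=
  isOpen_of_countable_quotient_of_iUnion_isClosed H (K := fun _ : Unit => (H : Set G))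
    (fun _ => hH) (by rw [iUnion_const])

end Baire

/-! ### The abstract subgroup generated by a compact set is `K_σ` -/
section Generated

/-- The symmetrised set `S ∪ S⁻¹` is stable under inversion. [folklore] -/
private theorem inv_union_inv {M : Type*} [Group M] (S : Set M) : (S ∪ S⁻¹)⁻¹ = S ∪ S⁻¹ := by
  rw [union_inv, inv_inv, union_comm]

/-- The ABSTRACT subgroup generated by `S` is the union of the bounded-width product sets
`(S ∪ S⁻¹) ^ n`, `n : ℕ` (words of length `n` in `S` and `S⁻¹`) — DDMS's `S^∞ = ⋃ₙ S⁽ⁿ⁾` for the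
symmetrised set. [cite: DDMSAnalyticProP1999, Ch.1 Exercise 18 (i)] -/
theorem coe_closure_eq_iUnion_pow_union_inv {M : Type*} [Group M] (S : Set M) :
    ((Subgroup.closure S : Subgroup M) : Set M) = ⋃ n : ℕ, (S ∪ S⁻¹) ^ n := by
  apply Subset.antisymm
  · intro x hx
    induction hx using Subgroup.closure_induction with
    | mem y hy => exact mem_iUnion.mpr ⟨1, by rw [pow_one]; exact Or.inl hy⟩
    | one => exact mem_iUnion.mpr ⟨0, by rw [pow_zero]; exact mem_one.mpr rfl⟩
    | mul y z _ _ hy hz =>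
      obtain ⟨m, hm⟩ := mem_iUnion.mp hy
      obtain ⟨n, hn⟩ := mem_iUnion.mp hz
      exact mem_iUnion.mpr ⟨m + n, by rw [pow_add]; exact mul_mem_mul hm hn⟩
    | inv y _ hy =>
      obtain ⟨n, hn⟩ := mem_iUnion.mp hy
      refine mem_iUnion.mpr ⟨n, ?_⟩
      rw [← inv_union_inv S, inv_pow, Set.mem_inv, inv_inv]
      exact hn
  · refine iUnion_subset fun n => ?_
    have hT : S ∪ S⁻¹ ⊆ ((Subgroup.closure S : Subgroup M) : Set M) := by
      refine union_subset Subgroup.subset_closure fun y hy => ?_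
      exact (Subgroup.inv_mem_iff _).mp (Subgroup.subset_closure (mem_inv.mp hy))
    rcases Nat.eq_zero_or_pos n with rfl | hn
    · rw [pow_zero]
      exact fun y hy => by rw [mem_one.mp hy]; exact (Subgroup.closure S).one_mem
    · calc (S ∪ S⁻¹) ^ n ⊆ (((Subgroup.closure S : Subgroup M) : Set M)) ^ n :=
            pow_subset_pow_left hT
        _ = ((Subgroup.closure S : Subgroup M) : Set M) := coe_set_pow hn.ne' _

/-- Powers of a compact set are compact. [folklore] -/
private theorem isCompact_pow {S : Set G} (hS : IsCompact S) : ∀ n : ℕ, IsCompact (S ^ n)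
  | 0 => by rw [pow_zero]; exact isCompact_singleton
  | n + 1 => by rw [pow_succ]; exact (isCompact_pow hS n).mul hS

/-- For compact `S`, every bounded-width product set `(S ∪ S⁻¹) ^ n` is compact. [folklore] -/
private theorem isCompact_union_inv_pow {S : Set G} (hS : IsCompact S) (n : ℕ) :
    IsCompact ((S ∪ S⁻¹) ^ n) :=
  isCompact_pow (hS.union hS.inv) n

/-- In a HAUSDORFF Baire topological group, the abstract subgroup generated by a COMPACT subset is
open as soon as it has countable index (it is `K_σ`). [cite: Gao2009InvariantDST, §2.3 Thm 2.3.2 (Pettis) and Exercise 2.3.3]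
[cite: DDMSAnalyticProP1999, Ch.1 Exercise 18 (i)] -/
theorem isOpen_closure_of_countable_quotient_of_isCompact [T2Space G] [BaireSpace G] {S : Set G}
    (hS : IsCompact S) [Countable (G ⧸ (Subgroup.closure S : Subgroup G))] :
    IsOpen ((Subgroup.closure S : Subgroup G) : Set G) :=
  isOpen_of_countable_quotient_of_iUnion_isClosed (Subgroup.closure S)
    (fun n => (isCompact_union_inv_pow hS n).isClosed) (coe_closure_eq_iUnion_pow_union_inv S)

/-- In a HAUSDORFF Baire topological group, the abstract subgroup generated by a COMPACT subset is
open as soon as it has finite index. [cite: Gao2009InvariantDST, §2.3 Thm 2.3.2 (Pettis) and Exercise 2.3.3]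
[cite: DDMSAnalyticProP1999, Ch.1 Exercise 18 (i)] -/
theorem isOpen_closure_of_finiteIndex_of_isCompact [T2Space G] [BaireSpace G] {S : Set G}
    (hS : IsCompact S) [(Subgroup.closure S : Subgroup G).FiniteIndex] :
    IsOpen ((Subgroup.closure S : Subgroup G) : Set G) :=
  isOpen_of_finiteIndex_of_iUnion_isClosed (Subgroup.closure S)
    (fun n => (isCompact_union_inv_pow hS n).isClosed) (coe_closure_eq_iUnion_pow_union_inv S)

end Generated

/-! ### Compact Hausdorff groups: the equivalences -/

section Compact

/-! Every topological group is regular, hence `R₁`; a compact one is therefore locally compact and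
BAIRE (`BaireSpace.of_t2Space_locallyCompactSpace`) — no Hausdorff hypothesis is needed below except
where compact sets must be closed. -/

variable [CompactSpace G]

/-- In a compact group an open subgroup has finite index (finitely many cosets). [cite: DDMSAnalyticProP1999, Prop 1.2 (i)] -/
theorem finite_quotient_of_isOpen (H : Subgroup G) (hH : IsOpen (H : Set G)) : Finite (G ⧸ H) :=
  haveI : DiscreteTopology (G ⧸ H) := QuotientGroup.discreteTopology hH
  finite_of_compact_of_discrete

/-- **`K_σ` subgroups of compact groups: open ⟺ countable index** (DDMS Prop. 1.2 (i) has "closed: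
open ⟺ finite index"; the `K_σ`/countable upgrade is the Baire category theorem, DDMS Ch. 3 Ex. 6).
[cite: DDMSAnalyticProP1999, Prop 1.2 (i)]
[cite: DDMSAnalyticProP1999, Ch.3 Exercise 6] -/
theorem isOpen_iff_countable_quotient_of_iUnion_isClosed (H : Subgroup G) {ι : Type*} [Countable ι]
    {K : ι → Set G} (hK : ∀ i, IsClosed (K i)) (hHK : (H : Set G) = ⋃ i, K i) :
    IsOpen (H : Set G) ↔ Countable (G ⧸ H) := by
  refine ⟨fun h => ?_, fun _ => isOpen_of_countable_quotient_of_iUnion_isClosed H hK hHK⟩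
  haveI := finite_quotient_of_isOpen H h
  infer_instance

/-- **`K_σ` subgroups of compact groups: open ⟺ some closed piece has non-empty interior.**
[cite: DDMSAnalyticProP1999, Ch.3 Exercise 6] -/
theorem isOpen_iff_exists_nonempty_interior_of_iUnion_isClosed (H : Subgroup G) {ι : Type*}
    [Countable ι] {K : ι → Set G} (hK : ∀ i, IsClosed (K i)) (hHK : (H : Set G) = ⋃ i, K i) :
    IsOpen (H : Set G) ↔ ∃ i, (interior (K i)).Nonempty := by
  refine ⟨fun h => ?_, fun ⟨i, hi⟩ =>
    isOpen_of_nonempty_interior_of_subset H (hHK ▸ subset_iUnion K i) hi⟩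
  haveI := finite_quotient_of_isOpen H h
  exact exists_nonempty_interior_of_countable_quotient_of_iUnion_isClosed H hK hHK

/-- A closed subgroup of a compact group is open iff it has countable (equivalently finite) index.
[cite: DDMSAnalyticProP1999, Prop 1.2 (i)]
[cite: Gao2009InvariantDST, §2.2 Exercise 2.2.6] -/
theorem isOpen_iff_countable_quotient_of_isClosed (H : Subgroup G) (hH : IsClosed (H : Set G)) :
    IsOpen (H : Set G) ↔ Countable (G ⧸ H) :=
  isOpen_iff_countable_quotient_of_iUnion_isClosed H (K := fun _ : Unit => (H : Set G))
    (fun _ => hH) (by rw [iUnion_const])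

/-- **Word-width form (abstract subgroup generated by a compact set), index version.** In a compact
Hausdorff group, `Subgroup.closure S` for compact `S` is open iff it has countable index.
[cite: DDMSAnalyticProP1999, Ch.1 Exercise 18 (i)]
[cite: DDMSAnalyticProP1999, Prop 1.2 (i)] -/
theorem isOpen_closure_iff_countable_quotient_of_isCompact [T2Space G] {S : Set G} (hS : IsCompact S) :
    IsOpen ((Subgroup.closure S : Subgroup G) : Set G) ↔
      Countable (G ⧸ (Subgroup.closure S : Subgroup G)) :=
  isOpen_iff_countable_quotient_of_iUnion_isClosed (Subgroup.closure S)
    (fun n => (isCompact_union_inv_pow hS n).isClosed) (coe_closure_eq_iUnion_pow_union_inv S)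

/-- **Word-width form, interior version.** In a compact Hausdorff group, `Subgroup.closure S` for
compact `S` is open iff some bounded-width product set `(S ∪ S⁻¹) ^ n` has non-empty interior — the
form in which UNIFORM WIDTH BOUNDS for word values enter strong-completeness arguments (DDMS Ch. 1
Ex. 18 (iii)). [cite: DDMSAnalyticProP1999, Ch.1 Exercise 18 (i)]
[cite: DDMSAnalyticProP1999, Ch.3 Exercise 6] -/
theorem isOpen_closure_iff_exists_nonempty_interior_pow_of_isCompact [T2Space G] {S : Set G}
    (hS : IsCompact S) :
    IsOpen ((Subgroup.closure S : Subgroup G) : Set G) ↔ ∃ n : ℕ, (interior ((S ∪ S⁻¹) ^ n)).Nonempty :=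
  isOpen_iff_exists_nonempty_interior_of_iUnion_isClosed (Subgroup.closure S)
    (fun n => (isCompact_union_inv_pow hS n).isClosed) (coe_closure_eq_iUnion_pow_union_inv S)

omit [CompactSpace G] in
/-- **Closed ⟺ open for abstract subgroups whose topological closure is open.** In a topological
group, if the topological closure of `Subgroup.closure S` is open — e.g. `S` = the `p`-th powers and
commutators of a topologically finitely generated profinite group — then the abstract subgroup is
closed iff it is open (and then, for compact `S` in a compact Hausdorff group, iff it has countable
index, by `isOpen_closure_iff_countable_quotient_of_isCompact`). [cite: DDMSAnalyticProP1999, Prop 1.2 (i)] -/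
theorem isClosed_closure_iff_isOpen_of_isOpen_topologicalClosure {S : Set G}
    (hopen : IsOpen (((Subgroup.closure S : Subgroup G).topologicalClosure : Subgroup G) : Set G)) :
    IsClosed ((Subgroup.closure S : Subgroup G) : Set G) ↔
      IsOpen ((Subgroup.closure S : Subgroup G) : Set G) := by
  refine ⟨fun h => ?_, fun h => (Subgroup.isClosed_of_isOpen _ h)⟩
  have heq : ((Subgroup.closure S : Subgroup G).topologicalClosure : Set G) =
      ((Subgroup.closure S : Subgroup G) : Set G) := by
    rw [Subgroup.topologicalClosure_coe]
    exact h.closure_eq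
  rw [← heq]
  exact hopen

/-! ### Finite-kernel lifting -/

/-- Cosets modulo `H` are covered by (cosets modulo `H ⊔ N`) × `N` when `N` is normal: the index of
`H` is at most `[M : H ⊔ N] · |N|`; in particular `M ⧸ H` is finite when `M ⧸ (H ⊔ N)` and `N` are.
[folklore] -/
private theorem finite_quotient_of_finite_quotient_sup_of_finite {M : Type*} [Group M] (H N : Subgroup M)
    [N.Normal] [Finite (M ⧸ (H ⊔ N))] [Finite N] : Finite (M ⧸ H) := by
  classical
  let f : (M ⧸ (H ⊔ N)) × N → M ⧸ H := fun q => QuotientGroup.mk (q.1.out * (q.2 : M))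
  refine Finite.of_surjective f fun c => ?_
  induction c using QuotientGroup.induction_on with
  | H g =>
    set q : M ⧸ (H ⊔ N) := QuotientGroup.mk g with hq
    -- `q.out⁻¹ * g ∈ H ⊔ N = N * H`, so `q.out⁻¹ * g = n * h`
    have hrg : q.out⁻¹ * g ∈ H ⊔ N := QuotientGroup.eq.mp ((QuotientGroup.out_eq' q).trans hq)
    have hmem : q.out⁻¹ * g ∈ ((N ⊔ H : Subgroup M) : Set M) := by
      rw [sup_comm]; exact hrg
    rw [Subgroup.normal_mul] at hmem
    obtain ⟨n, hn, h, hh, hy⟩ := Set.mem_mul.mp hmem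
    refine ⟨(q, ⟨n, hn⟩), ?_⟩
    show (QuotientGroup.mk (q.out * n) : M ⧸ H) = QuotientGroup.mk g
    rw [QuotientGroup.eq, mul_inv_rev, mul_assoc, ← hy, inv_mul_cancel_left]
    exact hh

/-- **Finite-kernel lifting.** In a compact group, let `N` be a FINITE normal subgroup and `H` a `K_σ`
subgroup with `H ⊔ N` open. Then `H` is open (`H` has index `≤ [G : H ⊔ N]·|N| < ∞`, then Baire).
[cite: DDMSAnalyticProP1999, Ch.3 Exercise 6]
[cite: Gao2009InvariantDST, §2.3 Thm 2.3.2 (Pettis) and Exercise 2.3.3] -/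
theorem isOpen_of_isOpen_sup_of_finite_normal (H N : Subgroup G) [N.Normal] [Finite N]
    (hHN : IsOpen ((H ⊔ N : Subgroup G) : Set G)) {ι : Type*} [Countable ι] {K : ι → Set G}
    (hK : ∀ i, IsClosed (K i)) (hHK : (H : Set G) = ⋃ i, K i) : IsOpen (H : Set G) := by
  haveI := finite_quotient_of_isOpen (H ⊔ N) hHN
  haveI := finite_quotient_of_finite_quotient_sup_of_finite H N
  exact isOpen_of_countable_quotient_of_iUnion_isClosed H hK hHK

/-- **Finite-kernel lifting, image form.** In a compact group, let `N` be a FINITE normal subgroup and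
`H` a `K_σ` subgroup whose image in `G ⧸ N` is open. Then `H` is open. [cite: DDMSAnalyticProP1999, Ch.3 Exercise 6]
[cite: Gao2009InvariantDST, §2.3 Thm 2.3.2 (Pettis) and Exercise 2.3.3] -/
theorem isOpen_of_isOpen_map_mk_of_finite_normal (H N : Subgroup G) [N.Normal] [Finite N]
    (hHN : IsOpen ((H.map (QuotientGroup.mk' N) : Subgroup (G ⧸ N)) : Set (G ⧸ N)))
    {ι : Type*} [Countable ι] {K : ι → Set G} (hK : ∀ i, IsClosed (K i))
    (hHK : (H : Set G) = ⋃ i, K i) : IsOpen (H : Set G) := by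
  refine isOpen_of_isOpen_sup_of_finite_normal H N ?_ hK hHK
  have hcomap : (H.map (QuotientGroup.mk' N)).comap (QuotientGroup.mk' N) = H ⊔ N := by
    rw [Subgroup.comap_map_eq, QuotientGroup.ker_mk']
  rw [← hcomap, Subgroup.coe_comap]
  exact hHN.preimage (QuotientGroup.continuous_mk (N := N))

/-! ### DDMS Ch. 1 Exercise 18 (i): `S^∞` is closed iff it has finite width -/

/-- **[DDMS] Ch. 1 Exercise 18 (i), "only if".** Let `S` be a closed subset of a compact Hausdorff group
with `1 ∈ S = S⁻¹`, and suppose `S^∞ := ⋃ n, S ^ n` (the abstract subgroup generated by `S`) is CLOSED.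
Then `S^∞ = S ^ n` for some `n` (finite width).  Proof as hinted in print ("use Baire's Category
Theorem", Ch. 3 Ex. 6): `S^∞` is then a compact group covered by the closed sets `S ^ m`, so some `S ^ m`
contains a non-empty open subset of `S^∞`; finitely many left translates of it cover the compact `S^∞`,
and each translating element lies in some `S ^ k`. [cite: DDMSAnalyticProP1999, Ch.1 Exercise 18 (i)]
[cite: DDMSAnalyticProP1999, Ch.3 Exercise 6] -/
theorem exists_iUnion_pow_eq_pow_of_isClosed [T2Space G] {S : Set G} (hS : IsClosed S)
    (h1 : (1 : G) ∈ S) (hsymm : S⁻¹ = S) (hcl : IsClosed (⋃ n : ℕ, S ^ n)) :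
    ∃ n : ℕ, (⋃ k : ℕ, S ^ k) = S ^ n := by
  classical
  have hSc : IsCompact S := hS.isCompact
  -- the abstract subgroup generated by `S`, as a set, is `⋃ S ^ k`
  have hA : ((Subgroup.closure S : Subgroup G) : Set G) = ⋃ k : ℕ, S ^ k := by
    rw [coe_closure_eq_iUnion_pow_union_inv, hsymm, union_self]
  set A : Subgroup G := Subgroup.closure S with hAdef
  have hmemA : ∀ {x : G}, x ∈ A ↔ x ∈ ⋃ k : ℕ, S ^ k := fun {x} => by
    rw [← SetLike.mem_coe, hA]
  haveI : CompactSpace A := isCompact_iff_compactSpace.mp (by rw [hA]; exact hcl.isCompact)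
  -- the closed pieces `S ^ n ∩ A` of the compact group `A`
  let K : ℕ → Set A := fun n => ((↑) : A → G) ⁻¹' (S ^ n)
  have hK : ∀ n, IsClosed (K n) := fun n =>
    ((isCompact_pow hSc n).isClosed).preimage continuous_subtype_val
  have hKU : ((⊤ : Subgroup A) : Set A) = ⋃ n, K n := by
    ext x
    simp only [Subgroup.coe_top, mem_univ, true_iff, mem_iUnion, K, mem_preimage]
    exact mem_iUnion.mp (hmemA.mp x.2)
  haveI : Subsingleton (A ⧸ (⊤ : Subgroup A)) := QuotientGroup.subsingleton_quotient_top
  obtain ⟨m, hm⟩ :=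
    exists_nonempty_interior_of_countable_quotient_of_iUnion_isClosed (⊤ : Subgroup A) hK hKU
  -- finitely many left translates of `K m` cover the compact group `A`
  obtain ⟨t, ht⟩ := compact_covered_by_mul_left_translates isCompact_univ hm
  have hn : ∀ g : A, ∃ n : ℕ, (g : G) ∈ S ^ n := fun g => mem_iUnion.mp (hmemA.mp g.2)
  choose n hn using hn
  refine ⟨t.sup n + m, Subset.antisymm ?_ (subset_iUnion (fun k => S ^ k) _)⟩
  intro x hx
  have hxA : x ∈ A := hmemA.mpr hx
  obtain ⟨g, hg, hgx⟩ : ∃ g ∈ t, g * ⟨x, hxA⟩ ∈ K m := by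
    simpa only [mem_iUnion, mem_preimage, exists_prop] using ht (mem_univ (⟨x, hxA⟩ : A))
  -- `x = g⁻¹ * (g * x)` with `g⁻¹ ∈ (S ^ n g)⁻¹ = S ^ n g` and `g * x ∈ S ^ m`
  have hginv : ((g : G))⁻¹ ∈ S ^ n g := by
    have h := Set.inv_mem_inv.mpr (hn g)
    rwa [← inv_pow, hsymm] at h
  have hgx' : (g : G) * x ∈ S ^ m := hgx
  have hmem : (g : G)⁻¹ * ((g : G) * x) ∈ S ^ (n g + m) := by
    rw [pow_add]; exact mul_mem_mul hginv hgx'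
  rw [inv_mul_cancel_left] at hmem
  exact pow_subset_pow_right h1 (Nat.add_le_add_right (Finset.le_sup hg) m) hmem

/-- **[DDMS] Ch. 1 Exercise 18 (i).** For a closed subset `S` of a compact Hausdorff group with
`1 ∈ S = S⁻¹`: `S^∞ = ⋃ n, S ^ n` is closed iff `S^∞ = S ^ n` for some `n` ("closed ⟺ finite width";
the "if" direction is compactness of `S ^ n`).  With `S = w(G) ∪ w(G)⁻¹` for a word `w` this is the
statement that the verbal subgroup `w(G)` is closed iff `w` has finite width in `G` (Ex. 18 (iii)).
[cite: DDMSAnalyticProP1999, Ch.1 Exercise 18 (i)] -/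
theorem isClosed_iUnion_pow_iff_exists_eq_pow [T2Space G] {S : Set G} (hS : IsClosed S)
    (h1 : (1 : G) ∈ S) (hsymm : S⁻¹ = S) :
    IsClosed (⋃ n : ℕ, S ^ n) ↔ ∃ n : ℕ, (⋃ k : ℕ, S ^ k) = S ^ n := by
  refine ⟨exists_iUnion_pow_eq_pow_of_isClosed hS h1 hsymm, fun ⟨n, hn⟩ => ?_⟩
  rw [hn]
  exact (isCompact_pow hS.isCompact n).isClosed

end Compact

end Literature.GroupTheory
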